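import Summits.BirchSwinnertonDyer.Rank2.ToyRankThreeLocalRootNumbers
import Summits.BirchSwinnertonDyer.Rank2.Family81517MinimalOrdinary
import HarnessLib

/-!
# The conductor-`15` reference curve `[1, 1, 1, 0, 0]` of planner p2's GEN-15 crux X₂ (`LambdaZeroAtFifteen`):
# elliptic, globally minimal, good ORDINARY at `2`, multiplicative at `3` and `5`, conductor `15`

Cell `bsd-rank2`, seat `bsd-rank2-eng-2` GEN 4 (director-bsd g7 06:52:06Z / g8 07:16:25Z: «ONCE eng lands the X₂
Lean certificate»; my feasibility census on STATUS ~07:45Z: conjuncts (a) `conductorNorm = 15`, (b)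
`IsOrdinaryAt 2`, (c) `HasUniqueRationalTwoTorsionX (−1)` are provable now — (c) is in
`Rank2/TwoAdicLambdaTransportTwoTorsionFacts.lean`; (a) and (b) are THIS file; the `λ = 0` clause (d) is
computation-grade). Template: the toy files `Rank2/ToyRankThree{LocalRootNumbers,RootNumber,KatoInputsAtTwo}.lean`.

* `refFifteen_Δ = −15`, `refFifteen_c₄ = 1`, `refFifteen_isElliptic`, `refFifteen_isGloballyMinimal`
  (`|Δ| = 15 < 2¹²`), `refFifteen_integralModelInt`, `refFifteen_minimalDiscriminantInt`;
* `refFifteen_hasGoodReductionAtPrime_two`, `refFifteenInt_map_zmod_two` (`y² + xy + y = x³ + x²` over `𝔽₂`,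
  `4` points, `a₂ = −1`), **`refFifteen_isOrdinaryAt_two`**;
* at a place with `v(Δ) < 1` the prime below it is `3` or `5`, `c₄ = 1` is a unit, the reduction is
  multiplicative (`refFifteen_hasMultiplicativeReductionAt`), and **`refFifteen_conductorNorm : N = 15`**
  (`f_v = 1` at the two multiplicative places, `0` elsewhere).

THEOREMS ONLY (no definition, no named fact, no `sorry`); the curve is written literally `⟨1, 1, 1, 0, 0⟩` (p2's
`refFifteen` is then a `def` unfolding to it). PARTITION: none — r_an ≥ 2, summit axis S0; TWIN (D-0056): n/a.
B1 honesty: elementary reduction data of ONE explicit curve; no S0 motion.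

References: J. H. Silverman, *AEC* (2009) VII.1 Rem. 1.1, VII.5 Prop. 5.1, V.2 [SilvermanAEC2009];
*ATAEC* (1994) IV.10.2 [Silverman1994]; K. Matsuno, *Int. J. Number Theory* 4 (2008) Example (conductor 15)
[Matsuno2008].
-/

set_option linter.dupNamespace false

noncomputable section

open IsDedekindDomain IsDedekindDomain.HeightOneSpectrum WeierstrassCurve
  Rat.HeightOneSpectrum Literature.NumberTheory.EllipticCurves

namespace Summit.BirchSwinnertonDyer.Rank2

/-! ### §1 Invariants, ellipticity, minimality -/

/-- `Δ([1,1,1,0,0]) = −15`. [cite: SilvermanAEC2009, III §1] -/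
theorem refFifteen_Δ : (⟨1, 1, 1, 0, 0⟩ : WeierstrassCurve ℚ).Δ = -15 := by
  norm_num [WeierstrassCurve.Δ, WeierstrassCurve.b₂, WeierstrassCurve.b₄, WeierstrassCurve.b₆,
    WeierstrassCurve.b₈]

/-- `c₄([1,1,1,0,0]) = 1`. [cite: SilvermanAEC2009, III §1] -/
theorem refFifteen_c₄ : (⟨1, 1, 1, 0, 0⟩ : WeierstrassCurve ℚ).c₄ = 1 := by
  norm_num [WeierstrassCurve.c₄, WeierstrassCurve.b₂, WeierstrassCurve.b₄]

/-- The integer model: `Δ = −15`. [cite: SilvermanAEC2009, III §1] -/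
theorem refFifteenInt_Δ : (⟨1, 1, 1, 0, 0⟩ : WeierstrassCurve ℤ).Δ = -15 := by
  simp [WeierstrassCurve.Δ, WeierstrassCurve.b₂, WeierstrassCurve.b₄, WeierstrassCurve.b₆,
    WeierstrassCurve.b₈]

/-- The rational model is the base change of the integer model. [folklore] -/
theorem refFifteenInt_map_eq :
    (⟨1, 1, 1, 0, 0⟩ : WeierstrassCurve ℤ).map (Int.castRingHom ℚ) = ⟨1, 1, 1, 0, 0⟩ := by
  ext <;> simp [WeierstrassCurve.map]

/-- `[1,1,1,0,0]` is an elliptic curve (`Δ = −15 ≠ 0`). [folklore] -/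
theorem refFifteen_isElliptic : (⟨1, 1, 1, 0, 0⟩ : WeierstrassCurve ℚ).IsElliptic :=
  ⟨isUnit_iff_ne_zero.mpr (by rw [refFifteen_Δ]; norm_num)⟩

/-- **`[1,1,1,0,0]` is a global minimal model** (`ℓ¹² ∤ −15` for every prime `ℓ`).
[cite: SilvermanAEC2009, VII Remark 1.1] -/
theorem refFifteen_isGloballyMinimal : (⟨1, 1, 1, 0, 0⟩ : WeierstrassCurve ℚ).IsGloballyMinimal := by
  have e : (⟨1, 1, 1, 0, 0⟩ : WeierstrassCurve ℚ) =
      ⟨((1 : ℤ) : ℚ), ((1 : ℤ) : ℚ), ((1 : ℤ) : ℚ), ((0 : ℤ) : ℚ), ((0 : ℤ) : ℚ)⟩ := by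
    ext <;> norm_num
  rw [e]
  refine Rank1Residual.X11RankOneCertificates.isGloballyMinimal_of_int_criterion 1 1 1 0 0
    fun q hq hboth ↦ ?_
  have h12 := hboth.1
  have hD : Rank1Residual.X11RankOneCertificates.discOf [1, 1, 1, 0, 0] = -15 := by decide
  rw [hD] at h12
  have hnat : q ^ 12 ∣ 15 := by
    have h' : ((q ^ 12 : ℕ) : ℤ) ∣ (15 : ℕ) := by
      rw [Nat.cast_pow]; exact (dvd_neg.mp h12)
    exact Int.natCast_dvd_natCast.mp h'
  have hle : q ^ 12 ≤ 15 := Nat.le_of_dvd (by norm_num) hnat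
  have h2 : 2 ^ 12 ≤ q ^ 12 := Nat.pow_le_pow_left hq.two_le 12
  norm_num at h2
  omega

/-- The rational model is the base change (`baseChange`) of the integer model. [folklore] -/
theorem refFifteenInt_baseChange :
    (⟨1, 1, 1, 0, 0⟩ : WeierstrassCurve ℤ).baseChange ℚ = ⟨1, 1, 1, 0, 0⟩ := by
  rw [baseChange_int_eq_map]; exact refFifteenInt_map_eq

/-- The tree's integral model of `[1,1,1,0,0]` is `[1,1,1,0,0]` itself. [cite: SilvermanAEC2009, VII Remark 1.1] -/
theorem refFifteen_integralModelInt :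
    @integralModelInt (⟨1, 1, 1, 0, 0⟩ : WeierstrassCurve ℚ) refFifteen_isGloballyMinimal =
      ⟨1, 1, 1, 0, 0⟩ := by
  have key : ∀ (X : WeierstrassCurve ℚ) (hX : X.IsGloballyMinimal),
      (⟨1, 1, 1, 0, 0⟩ : WeierstrassCurve ℤ).baseChange ℚ = X →
        @integralModelInt X hX = ⟨1, 1, 1, 0, 0⟩ := by
    rintro X hX rfl
    exact integralModelInt_baseChange_int _
  exact key _ _ refFifteenInt_baseChange

/-- `Δ_min([1,1,1,0,0]) = −15`. [cite: SilvermanAEC2009, VII Remark 1.1] -/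
theorem refFifteen_minimalDiscriminantInt :
    @minimalDiscriminantInt (⟨1, 1, 1, 0, 0⟩ : WeierstrassCurve ℚ) refFifteen_isGloballyMinimal = -15 := by
  rw [minimalDiscriminantInt, refFifteen_integralModelInt, refFifteenInt_Δ]

/-! ### §2 Good ordinary reduction at `2` -/

/-- Good reduction at `2` (`Δ_min = −15` odd). [cite: SilvermanAEC2009, VII.5 Prop. 5.1(a)] -/
theorem refFifteen_hasGoodReductionAtPrime_two :
    (⟨1, 1, 1, 0, 0⟩ : WeierstrassCurve ℚ).HasGoodReductionAtPrime 2 := by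
  haveI := refFifteen_isGloballyMinimal
  refine hasGoodReductionAtPrime_of_not_dvd _ 2 ?_
  rw [refFifteen_minimalDiscriminantInt]; norm_num

/-- The reduction modulo `2` is `y² + xy + y = x³ + x²` (`⟨1, 1, 1, 0, 0⟩` over `𝔽₂`). [folklore] -/
theorem refFifteenInt_map_zmod_two :
    (⟨1, 1, 1, 0, 0⟩ : WeierstrassCurve ℤ).map (Int.castRingHom (ZMod 2)) = ⟨1, 1, 1, 0, 0⟩ := by
  ext <;> simp [WeierstrassCurve.map]

/-- `#Ẽ(𝔽₂) = 4` for `y² + xy + y = x³ + x²` (points `O, (0,0), (0,1), (1,0)`). [folklore] -/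
theorem natCard_point_refFifteen_F2 :
    Nat.card (⟨1, 1, 1, 0, 0⟩ : WeierstrassCurve (ZMod 2)).toAffine.Point = 4 := by
  rw [natCard_point_eq_one_add_card _ (by decide)]; decide

/-- **`a₂([1,1,1,0,0]) = −1` is odd.** [cite: SilvermanAEC2009, V.2] -/
theorem refFifteen_not_two_dvd_frobeniusTrace :
    ¬ ((2 : ℕ) : ℤ) ∣ @frobeniusTrace (⟨1, 1, 1, 0, 0⟩ : WeierstrassCurve ℚ) refFifteen_isGloballyMinimal 2 := by
  rw [frobeniusTrace, reductionPointCount, refFifteen_integralModelInt, refFifteenInt_map_zmod_two,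
    natCard_point_refFifteen_F2]
  norm_num

/-- **`[1,1,1,0,0]` is good ORDINARY at `2`** (for any global-minimality witness). [cite: SilvermanAEC2009, V.2 and VII.5.1(a)] -/
theorem refFifteen_isOrdinaryAt_two (hmin : (⟨1, 1, 1, 0, 0⟩ : WeierstrassCurve ℚ).IsGloballyMinimal) :
    @IsOrdinaryAt (⟨1, 1, 1, 0, 0⟩ : WeierstrassCurve ℚ) hmin 2 _ :=
  ⟨refFifteen_hasGoodReductionAtPrime_two, refFifteen_not_two_dvd_frobeniusTrace⟩

/-! ### §3 Multiplicative reduction at `3`, `5`; the conductor `15` -/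

/-- `[1,1,1,0,0]` is integral at every finite place. [cite: SilvermanAEC2009, VIII.8] -/
theorem refFifteen_isIntegralAt (v : HeightOneSpectrum ℤ) :
    (⟨1, 1, 1, 0, 0⟩ : WeierstrassCurve ℚ).IsIntegralAt v := by
  rw [isIntegralAt_iff_valuation_le_one]
  exact ⟨by simp, by simp, by simp, by simp, by simp⟩

/-- At a place with `v(Δ) < 1` the prime below `v` is `3` or `5`. [folklore] -/
theorem refFifteen_natGenerator_mem {v : HeightOneSpectrum ℤ}
    (h : v.valuation ℚ (⟨1, 1, 1, 0, 0⟩ : WeierstrassCurve ℚ).Δ < 1) :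
    natGenerator v = 3 ∨ natGenerator v = 5 := by
  rw [refFifteen_Δ, show (-15 : ℚ) = ((-15 : ℤ) : ℚ) by norm_num,
    Literature.NumberTheory.EllipticCurves.Rat.valuation_intCast_lt_one_iff] at h
  have hp := prime_natGenerator v
  have h' : natGenerator v ∣ 15 := by
    have : (natGenerator v : ℤ) ∣ (15 : ℕ) := (Int.dvd_neg.mpr h : _)
    exact_mod_cast this
  rw [show (15 : ℕ) = 3 * 5 by norm_num, hp.dvd_mul] at h'
  rcases h' with h3 | h5
  · exact Or.inl ((Nat.prime_dvd_prime_iff_eq hp (by norm_num)).mp h3)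
  · exact Or.inr ((Nat.prime_dvd_prime_iff_eq hp (by norm_num)).mp h5)

/-- Multiplicative reduction at every bad place (`c₄ = 1`). [cite: SilvermanAEC2009, VII.5 Prop. 5.1(b)] -/
theorem refFifteen_hasMultiplicativeReductionAt {v : HeightOneSpectrum ℤ}
    (h : v.valuation ℚ (⟨1, 1, 1, 0, 0⟩ : WeierstrassCurve ℚ).Δ < 1) :
    (⟨1, 1, 1, 0, 0⟩ : WeierstrassCurve ℚ).HasMultiplicativeReductionAt v :=
  haveI := refFifteen_isElliptic
  hasMultiplicativeReductionAt_of_valuation_c₄_eq_one (refFifteen_isIntegralAt v)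
    (by rw [refFifteen_c₄, map_one]) h

/-- **The conductor of `[1,1,1,0,0]` is `15`.** [cite: Silverman1994, IV.10.2] -/
theorem refFifteen_conductorNorm : (⟨1, 1, 1, 0, 0⟩ : WeierstrassCurve ℚ).conductorNorm ℤ = 15 := by
  haveI := refFifteen_isElliptic
  set E : WeierstrassCurve ℚ := ⟨1, 1, 1, 0, 0⟩ with hE
  have h3 : Nat.Prime 3 := by norm_num
  have h5 : Nat.Prime 5 := by norm_num
  have hfac : ∀ p : ℕ, p.Prime → (15 : ℕ).factorization p = if p = 3 ∨ p = 5 then 1 else 0 := by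
    intro p hp
    rw [show (15 : ℕ) = 3 * 5 by norm_num, Nat.factorization_mul (by norm_num) (by norm_num)]
    simp only [Finsupp.coe_add, Pi.add_apply, h3.factorization, h5.factorization, Finsupp.single_apply]
    by_cases e3 : p = 3
    · subst e3; norm_num
    by_cases e5 : p = 5
    · subst e5; norm_num
    simp [Ne.symm e3, Ne.symm e5, e3, e5]
  refine Nat.eq_of_factorization_eq (E.conductorNorm_pos_holds).ne' (by norm_num) fun p => ?_
  by_cases hp : p.Prime
  swap
  · rw [Nat.factorization_eq_zero_of_not_prime _ hp, Nat.factorization_eq_zero_of_not_prime _ hp]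
  rw [show p = ((⟨p, hp⟩ : Nat.Primes) : ℕ) from rfl, factorization_conductorNorm_primesEquiv_symm, hfac p hp]
  set v := (primesEquiv (R := ℤ)).symm ⟨p, hp⟩ with hv
  have hgen : natGenerator v = p :=
    Literature.NumberTheory.EllipticCurves.Rat.natGenerator_primesEquiv_symm ⟨p, hp⟩
  by_cases hbad : p = 3 ∨ p = 5
  · have hΔ : v.valuation ℚ E.Δ < 1 := by
      rw [refFifteen_Δ, show (-15 : ℚ) = ((-15 : ℤ) : ℚ) by norm_num,
        Literature.NumberTheory.EllipticCurves.Rat.valuation_intCast_lt_one_iff, hgen]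
      rcases hbad with hp' | hp' <;> rw [hp'] <;> norm_num
    rw [(conductorExponent_eq_one_iff_holds v E).mpr (refFifteen_hasMultiplicativeReductionAt hΔ), if_pos hbad]
  · have hΔ : v.valuation ℚ E.Δ = 1 := by
      rw [refFifteen_Δ, show (-15 : ℚ) = ((-15 : ℤ) : ℚ) by norm_num,
        Literature.NumberTheory.EllipticCurves.Rat.valuation_intCast_eq_one_iff, hgen, Int.dvd_neg]
      intro hd
      have hd' : p ∣ 15 := by exact_mod_cast hd
      rw [show (15 : ℕ) = 3 * 5 by norm_num, hp.dvd_mul] at hd'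
      rcases hd' with h' | h'
      · exact hbad (Or.inl ((Nat.prime_dvd_prime_iff_eq hp h3).mp h'))
      · exact hbad (Or.inr ((Nat.prime_dvd_prime_iff_eq hp h5).mp h'))
    rw [(conductorExponent_eq_zero_iff_holds v E).mpr
      (hasGoodReductionAt_of_valuation_Δ_eq_one_holds v E (refFifteen_isIntegralAt v) hΔ), if_neg hbad]

end Summit.BirchSwinnertonDyer.Rank2

end
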